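import Mathlib

/-!
# `GrenetZeon.DualUnipotentThreeHalves` (stmt-ValiantsHypothesis-24318), R2 `HeavyTopLaw` — IRREDUCIBLE NILPOTENT SPACES:
# kernel-checked data for the instance table (INSTANCES.md §7; instrument, director-valiant R259 (a))

The open loci of the small formats of R2 are governed by `ι(m)`, the maximal dimension of an IRREDUCIBLE linear
space of nilpotent `m × m` complex matrices (no common non-trivial invariant subspace) — Mathes–Omladič–Radjavi's
open question (LAA 149 (1991) §5).  `Cruxes/DualUnipotentThreeHalves/INSTANCES.md` §7 shows by the invariant-flag
certificate (✓ `…HeavyTopInvariantFlag.flagCheap_of_block_levels`) that `HeavyTopInst 4 6 ⟸ ι(4) ≤ 3 ∧ ι(5) ≤ 7 ∧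
ι(6) ≤ 11` and `HeavyTopInst 5 7 ⟸ ι(7) ≤ 19`.  This file certifies the three data points the table uses:

* `reducible_of_sq_zero` — a linear space of SQUARE-ZERO matrices is never irreducible: its members anticommute,
  so the kernel of any non-zero member is a common invariant subspace (this is why simple factors of generic
  Jordan type `(2,2,…)` never occur);
* `irrThree_nilpotent`, `irrThree_irreducible` — MOR's `Irr₃ = span{E₁₂+E₂₃, E₂₁−E₃₂} ⊂ M₃`: every member is
  cube-zero and the only invariant subspaces are `0` and `ℂ³` (`ι(3) ≥ 2`, in fact `= 2`);
* `irrFour_nilpotent`, `irrFour_irreducible` — NEW: `Irr(4,3) = span{E₁₂+E₂₃+E₃₄, E₂₁−E₃₂, E₃₁−E₄₂} ⊂ M₄`: every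
  member `M` has `M⁴ = 0` and the only invariant subspaces are `0` and `ℂ⁴`, so **`ι(4) ≥ 3`**.

Matrices are written as literals (no definitions).  Honest framing: data for the instrument; nothing here proves or
refutes `HeavyTopLaw`, 24318, S3b or 8062; `VP ≠ VNP` is not moved; no summit statement is proved here.
No definitions, no named facts. [Mathes–Omladič–Radjavi 1991 §5 for `Irr₃`; `Irr(4,3)` this seat]
-/

noncomputable section

-- single-conjunct layout: Sub = Summit, duplicated namespace component intended
set_option linter.dupNamespace false

namespace Summit.ValiantsHypothesis.ValiantsHypothesis.Theorems.GrenetZeon.HeavyTopIrreducibleData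

open Matrix

/-! ## §1 Square-zero spaces are reducible -/

/-- **Square-zero spaces are reducible.**  If every member of a linear space `W` of matrices squares to zero, then
members anticommute (`AB + BA = (A+B)² − A² − B² = 0`), so for any `A ∈ W` the kernel of `A` is invariant under
every `B ∈ W`: `A(Bv) = −B(Av) = 0`.  (For `A ≠ 0` nilpotent this is a proper non-zero invariant subspace.) [folklore] -/
theorem reducible_of_sq_zero {K : Type*} [Field K] {m : Type*} [Fintype m] [DecidableEq m]
    (W : Submodule K (Matrix m m K)) (hW : ∀ A ∈ W, A * A = 0) {A B : Matrix m m K} (hA : A ∈ W) (hB : B ∈ W)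
    (v : m → K) (hv : A *ᵥ v = 0) : A *ᵥ (B *ᵥ v) = 0 := by
  have hAB : A * B + B * A = 0 := by
    have h := hW (A + B) (W.add_mem hA hB)
    rw [add_mul, mul_add, mul_add, hW A hA, hW B hB, zero_add, add_zero] at h
    exact h
  have h2 : A * B = -(B * A) := eq_neg_of_add_eq_zero_left hAB
  rw [Matrix.mulVec_mulVec, h2, Matrix.neg_mulVec, ← Matrix.mulVec_mulVec, hv, Matrix.mulVec_zero, neg_zero]

/-! ## §2 `Irr₃ = span{E₁₂ + E₂₃, E₂₁ − E₃₂}` (Mathes–Omladič–Radjavi 1991, §5, `k = 1`) -/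

/-- Every member `s(E₁₂+E₂₃) + r(E₂₁−E₃₂)` of `Irr₃` is CUBE-ZERO. [MOR 1991 §5] -/
theorem irrThree_nilpotent (s r : ℂ) :
    (!![0, s, 0; r, 0, s; 0, -r, 0] : Matrix (Fin 3) (Fin 3) ℂ) ^ 3 = 0 := by
  ext i j
  fin_cases i <;> fin_cases j <;> simp [pow_succ, Matrix.mul_apply, Fin.sum_univ_three]
  all_goals (first | ring1 | simp | (ring_nf; simp))

/-- **`Irr₃` is irreducible**: a subspace of `ℂ³` invariant under `S = E₁₂+E₂₃` and `R = E₂₁−E₃₂` is `0` or `ℂ³`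
(the `S`-invariant subspaces are `⟨e₁⟩ ⊂ ⟨e₁,e₂⟩`, and `R e₁ = e₂`, `R e₂ = −e₃`).  Hence `ι(3) ≥ 2`. [MOR 1991 §5] -/
theorem irrThree_irreducible (U : Submodule ℂ (Fin 3 → ℂ))
    (hS : ∀ u ∈ U, (!![0, 1, 0; 0, 0, 1; 0, 0, 0] : Matrix (Fin 3) (Fin 3) ℂ) *ᵥ u ∈ U)
    (hR : ∀ u ∈ U, (!![0, 0, 0; 1, 0, 0; 0, -1, 0] : Matrix (Fin 3) (Fin 3) ℂ) *ᵥ u ∈ U) :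
    U = ⊥ ∨ U = ⊤ := by
  classical
  by_cases hU : U = ⊥
  · exact Or.inl hU
  right
  obtain ⟨u, huU, hu0⟩ := Submodule.exists_mem_ne_zero_of_ne_bot hU
  have hSv : ∀ v : Fin 3 → ℂ, (!![0, 1, 0; 0, 0, 1; 0, 0, 0] : Matrix (Fin 3) (Fin 3) ℂ) *ᵥ v = ![v 1, v 2, 0] := by
    intro v; ext i; fin_cases i <;> simp [Matrix.mulVec, dotProduct, Fin.sum_univ_three]
  have hRv : ∀ v : Fin 3 → ℂ, (!![0, 0, 0; 1, 0, 0; 0, -1, 0] : Matrix (Fin 3) (Fin 3) ℂ) *ᵥ v = ![0, v 0, -v 1] := by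
    intro v; ext i; fin_cases i <;> simp [Matrix.mulVec, dotProduct, Fin.sum_univ_three]
  -- `e₀ ∈ U`
  have he0 : (Pi.single 0 1 : Fin 3 → ℂ) ∈ U := by
    by_cases h2 : u 2 ≠ 0
    · have h := hS _ (hS _ huU)
      rw [hSv, hSv] at h
      have : (Pi.single 0 1 : Fin 3 → ℂ) = (u 2)⁻¹ • ![(![u 1, u 2, (0:ℂ)] : Fin 3 → ℂ) 1, (![u 1, u 2, (0:ℂ)] : Fin 3 → ℂ) 2, 0] := by
        ext i; fin_cases i <;> simp [h2]
      rw [this]; exact U.smul_mem _ h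
    · push Not at h2
      by_cases h1 : u 1 ≠ 0
      · have h := hS _ huU
        rw [hSv, h2] at h
        have : (Pi.single 0 1 : Fin 3 → ℂ) = (u 1)⁻¹ • (![u 1, (0:ℂ), 0] : Fin 3 → ℂ) := by
          ext i; fin_cases i <;> simp [h1]
        rw [this]; exact U.smul_mem _ h
      · push Not at h1
        have h0 : u 0 ≠ 0 := by
          intro h0; apply hu0; ext i; fin_cases i <;> simp [h0, h1, h2]
        have : (Pi.single 0 1 : Fin 3 → ℂ) = (u 0)⁻¹ • u := by
          ext i; fin_cases i <;> simp [h0, h1, h2]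
        rw [this]; exact U.smul_mem _ huU
  -- `e₁, e₂ ∈ U`
  have he1 : (Pi.single 1 1 : Fin 3 → ℂ) ∈ U := by
    have h := hR _ he0
    rw [hRv] at h
    have : (Pi.single 1 1 : Fin 3 → ℂ) = ![(0:ℂ), (Pi.single (0 : Fin 3) (1:ℂ) : Fin 3 → ℂ) 0, -(Pi.single (0 : Fin 3) (1:ℂ) : Fin 3 → ℂ) 1] := by
      ext i; fin_cases i <;> simp
    rw [this]; exact h
  have he2 : (Pi.single 2 1 : Fin 3 → ℂ) ∈ U := by
    have h := hR _ he1
    rw [hRv] at h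
    have : (Pi.single 2 1 : Fin 3 → ℂ) = (-1 : ℂ) • ![(0:ℂ), (Pi.single (1 : Fin 3) (1:ℂ) : Fin 3 → ℂ) 0, -(Pi.single (1 : Fin 3) (1:ℂ) : Fin 3 → ℂ) 1] := by
      ext i; fin_cases i <;> simp
    rw [this]; exact U.smul_mem _ h
  refine Submodule.eq_top_iff'.2 fun v => ?_
  have hv : v = v 0 • (Pi.single 0 1 : Fin 3 → ℂ) + v 1 • (Pi.single 1 1 : Fin 3 → ℂ) + v 2 • (Pi.single 2 1 : Fin 3 → ℂ) := by
    ext i; fin_cases i <;> simp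
  rw [hv]
  exact U.add_mem (U.add_mem (U.smul_mem _ he0) (U.smul_mem _ he1)) (U.smul_mem _ he2)

/-! ## §3 `Irr(4,3) = span{E₁₂+E₂₃+E₃₄, E₂₁−E₃₂, E₃₁−E₄₂}` — an irreducible nilpotent subspace of `M₄(ℂ)` of dimension `3` -/

/-- Every member `sJ₄ + a(E₂₁−E₃₂) + b(E₃₁−E₄₂)` of `Irr(4,3)` is nilpotent (`M⁴ = 0`; indeed `e₂ = −s(a−a)`,
`e₃ = s²(b−b)`, `e₄ = s²·a·0 − s³·0`). [this file] -/
theorem irrFour_nilpotent (s a b : ℂ) :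
    (!![0, s, 0, 0; a, 0, s, 0; b, -a, 0, s; 0, -b, 0, 0] : Matrix (Fin 4) (Fin 4) ℂ) ^ 4 = 0 := by
  ext i j
  fin_cases i <;> fin_cases j <;> simp [pow_succ, Matrix.mul_apply, Fin.sum_univ_four]
  all_goals (first | ring1 | simp | (ring_nf; simp))

/-- **`Irr(4,3)` is irreducible**: a subspace of `ℂ⁴` invariant under `J₄ = E₁₂+E₂₃+E₃₄`, `R₁ = E₂₁−E₃₂` and
`R₂ = E₃₁−E₄₂` is `0` or `ℂ⁴` (the `J₄`-invariant subspaces are `⟨e₁⟩ ⊂ ⟨e₁,e₂⟩ ⊂ ⟨e₁,e₂,e₃⟩`; `R₁ e₁ = e₂`,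
`R₁ e₂ = −e₃`, `R₂ e₂ = −e₄`).  With `irrFour_nilpotent` (the three matrices are linearly independent): **`ι(4) ≥ 3`**.
[this file] -/
theorem irrFour_irreducible (U : Submodule ℂ (Fin 4 → ℂ))
    (hJ : ∀ u ∈ U, (!![0, 1, 0, 0; 0, 0, 1, 0; 0, 0, 0, 1; 0, 0, 0, 0] : Matrix (Fin 4) (Fin 4) ℂ) *ᵥ u ∈ U)
    (hR1 : ∀ u ∈ U, (!![0, 0, 0, 0; 1, 0, 0, 0; 0, -1, 0, 0; 0, 0, 0, 0] : Matrix (Fin 4) (Fin 4) ℂ) *ᵥ u ∈ U)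
    (hR2 : ∀ u ∈ U, (!![0, 0, 0, 0; 0, 0, 0, 0; 1, 0, 0, 0; 0, -1, 0, 0] : Matrix (Fin 4) (Fin 4) ℂ) *ᵥ u ∈ U) :
    U = ⊥ ∨ U = ⊤ := by
  classical
  by_cases hU : U = ⊥
  · exact Or.inl hU
  right
  obtain ⟨u, huU, hu0⟩ := Submodule.exists_mem_ne_zero_of_ne_bot hU
  have hJv : ∀ v : Fin 4 → ℂ,
      (!![0, 1, 0, 0; 0, 0, 1, 0; 0, 0, 0, 1; 0, 0, 0, 0] : Matrix (Fin 4) (Fin 4) ℂ) *ᵥ v = ![v 1, v 2, v 3, 0] := by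
    intro v; ext i; fin_cases i <;> simp [Matrix.mulVec, dotProduct, Fin.sum_univ_four]
  have hR1v : ∀ v : Fin 4 → ℂ,
      (!![0, 0, 0, 0; 1, 0, 0, 0; 0, -1, 0, 0; 0, 0, 0, 0] : Matrix (Fin 4) (Fin 4) ℂ) *ᵥ v = ![0, v 0, -v 1, 0] := by
    intro v; ext i; fin_cases i <;> simp [Matrix.mulVec, dotProduct, Fin.sum_univ_four]
  have hR2v : ∀ v : Fin 4 → ℂ,
      (!![0, 0, 0, 0; 0, 0, 0, 0; 1, 0, 0, 0; 0, -1, 0, 0] : Matrix (Fin 4) (Fin 4) ℂ) *ᵥ v = ![0, 0, v 0, -v 1] := by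
    intro v; ext i; fin_cases i <;> simp [Matrix.mulVec, dotProduct, Fin.sum_univ_four]
  -- `e₀ ∈ U`: push the last non-zero coordinate of `u` to position `0` with `J₄`
  have he0 : (Pi.single 0 1 : Fin 4 → ℂ) ∈ U := by
    have hJ1 := hJ _ huU
    have hJ2 := hJ _ hJ1
    have hJ3 := hJ _ hJ2
    rw [hJv] at hJ1
    rw [hJv, hJv] at hJ2
    rw [hJv, hJv, hJv] at hJ3
    by_cases h3 : u 3 ≠ 0
    · have : (Pi.single 0 1 : Fin 4 → ℂ) = (u 3)⁻¹ •
          ![(![(![u 1, u 2, u 3, (0:ℂ)] : Fin 4 → ℂ) 1, (![u 1, u 2, u 3, (0:ℂ)] : Fin 4 → ℂ) 2,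
              (![u 1, u 2, u 3, (0:ℂ)] : Fin 4 → ℂ) 3, (0:ℂ)] : Fin 4 → ℂ) 1,
            (![(![u 1, u 2, u 3, (0:ℂ)] : Fin 4 → ℂ) 1, (![u 1, u 2, u 3, (0:ℂ)] : Fin 4 → ℂ) 2,
              (![u 1, u 2, u 3, (0:ℂ)] : Fin 4 → ℂ) 3, (0:ℂ)] : Fin 4 → ℂ) 2,
            (![(![u 1, u 2, u 3, (0:ℂ)] : Fin 4 → ℂ) 1, (![u 1, u 2, u 3, (0:ℂ)] : Fin 4 → ℂ) 2,
              (![u 1, u 2, u 3, (0:ℂ)] : Fin 4 → ℂ) 3, (0:ℂ)] : Fin 4 → ℂ) 3, 0] := by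
        ext i; fin_cases i <;> simp [h3]
      rw [this]; exact U.smul_mem _ hJ3
    · push Not at h3
      by_cases h2 : u 2 ≠ 0
      · have : (Pi.single 0 1 : Fin 4 → ℂ) = (u 2)⁻¹ •
            ![(![u 1, u 2, u 3, (0:ℂ)] : Fin 4 → ℂ) 1, (![u 1, u 2, u 3, (0:ℂ)] : Fin 4 → ℂ) 2,
              (![u 1, u 2, u 3, (0:ℂ)] : Fin 4 → ℂ) 3, 0] := by
          ext i; fin_cases i <;> simp [h2, h3]
        rw [this]; exact U.smul_mem _ hJ2
      · push Not at h2
        by_cases h1 : u 1 ≠ 0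
        · have : (Pi.single 0 1 : Fin 4 → ℂ) = (u 1)⁻¹ • (![u 1, u 2, u 3, (0:ℂ)] : Fin 4 → ℂ) := by
            ext i; fin_cases i <;> simp [h1, h2, h3]
          rw [this]; exact U.smul_mem _ hJ1
        · push Not at h1
          have h0 : u 0 ≠ 0 := by
            intro h0; apply hu0; ext i; fin_cases i <;> simp [h0, h1, h2, h3]
          have : (Pi.single 0 1 : Fin 4 → ℂ) = (u 0)⁻¹ • u := by
            ext i; fin_cases i <;> simp [h0, h1, h2, h3]
          rw [this]; exact U.smul_mem _ huU
  -- `e₁, e₂, e₃ ∈ U`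
  have he1 : (Pi.single 1 1 : Fin 4 → ℂ) ∈ U := by
    have h := hR1 _ he0
    rw [hR1v] at h
    have : (Pi.single 1 1 : Fin 4 → ℂ) =
        ![(0:ℂ), (Pi.single (0 : Fin 4) (1:ℂ) : Fin 4 → ℂ) 0, -(Pi.single (0 : Fin 4) (1:ℂ) : Fin 4 → ℂ) 1, 0] := by
      ext i; fin_cases i <;> simp
    rw [this]; exact h
  have he2 : (Pi.single 2 1 : Fin 4 → ℂ) ∈ U := by
    have h := hR1 _ he1
    rw [hR1v] at h
    have : (Pi.single 2 1 : Fin 4 → ℂ) = (-1 : ℂ) •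
        ![(0:ℂ), (Pi.single (1 : Fin 4) (1:ℂ) : Fin 4 → ℂ) 0, -(Pi.single (1 : Fin 4) (1:ℂ) : Fin 4 → ℂ) 1, 0] := by
      ext i; fin_cases i <;> simp
    rw [this]; exact U.smul_mem _ h
  have he3 : (Pi.single 3 1 : Fin 4 → ℂ) ∈ U := by
    have h := hR2 _ he1
    rw [hR2v] at h
    have : (Pi.single 3 1 : Fin 4 → ℂ) = (-1 : ℂ) •
        ![(0:ℂ), 0, (Pi.single (1 : Fin 4) (1:ℂ) : Fin 4 → ℂ) 0, -(Pi.single (1 : Fin 4) (1:ℂ) : Fin 4 → ℂ) 1] := by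
      ext i; fin_cases i <;> simp
    rw [this]; exact U.smul_mem _ h
  refine Submodule.eq_top_iff'.2 fun v => ?_
  have hv : v = v 0 • (Pi.single 0 1 : Fin 4 → ℂ) + v 1 • (Pi.single 1 1 : Fin 4 → ℂ) +
      v 2 • (Pi.single 2 1 : Fin 4 → ℂ) + v 3 • (Pi.single 3 1 : Fin 4 → ℂ) := by
    ext i; fin_cases i <;> simp
  rw [hv]
  exact U.add_mem (U.add_mem (U.add_mem (U.smul_mem _ he0) (U.smul_mem _ he1)) (U.smul_mem _ he2))
    (U.smul_mem _ he3)

/-- The three generators of `Irr(4,3)` are linearly independent (read off the entries `(1,2)`, `(2,1)`, `(3,1)`),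
so `dim Irr(4,3) = 3`. [this file] -/
theorem irrFour_independent (s a b : ℂ)
    (h : (!![0, s, 0, 0; a, 0, s, 0; b, -a, 0, s; 0, -b, 0, 0] : Matrix (Fin 4) (Fin 4) ℂ) = 0) :
    s = 0 ∧ a = 0 ∧ b = 0 := by
  have h1 := congr_fun (congr_fun h 0) 1
  have h2 := congr_fun (congr_fun h 1) 0
  have h3 := congr_fun (congr_fun h 2) 0
  simp at h1 h2 h3
  exact ⟨h1, h2, h3⟩

end Summit.ValiantsHypothesis.ValiantsHypothesis.Theorems.GrenetZeon.HeavyTopIrreducibleData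

end
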